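import Summits.QuantumFields.YangMills.Theorems.BalabanUVNodesN11Sect3SupplyChainObligationsDefs
import Summits.QuantumFields.YangMills.Theorems.BalabanUVNodesN11ThmP245OfSupplyChainRAssumedCoPH

/-!
# DAG node N11 — THE WITNESS-LEVEL 𝐑-STEP (𝐑ʷ) NAMED: `RStepWAt θ p k` ∕ `RStepW θ p` («𝐑 takes the 𝐓-image witness at level `k` to a §2 witness of `ρ_{k+1}` with the same
# terms»), its live-line inhabitant (A6), its law-level shadow ([III]'s p. 244 object `ROpLeaf (VOfRecord₁₃CoPH θ p)`), and THEOREM 1 OF [III] ∕ the node faces at a GENERIC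
# v1.7 parameter `θ` from dag-n11-e's NAMED obligations `SupplierObligations θ p σ` ∕ `NoExpansionObligation θ p σ` ∕ `SupplyChainAt θ p` + `RStepW θ p` — one token per side

HEADER — WORK-UNIT METADATA.  Cell `pub-ymgap`, YM-PLAN Track A (HUMAN RULING D-0062 ∕ D-0149 width seats), seat `pub-ymgap-dag-n11-w3` (g2; WIDTH SEAT 3∕4 on NODE n11 [B14],
director-ym №197), route `BalabanUVNodes` (v1.7 `CoPH` key), item K1⁷ `StabilityBAtRecordR13SepCoPH` = stmt-QuantumFields-20542 (DEFINITION lane `--kind definition --supports 20542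
--as helper`, count-neutral).  Continuation of dag-n11-e's hand-outs «Y» ∕ «Y₂» to this seat (p592685 ∕ p594830).  [III] = [Balaban1988Convergent], [IV] = [Balaban1989LargeFieldI],
[B16] = [Balaban1989LargeFieldII].  Over this seat's p594830 `…ThmP245OfSupplyChainRAssumedCoPH` (`rStepW_of_liveSel_of_rstep`, `rStepLaw_of_rStepW`, `rOpLeaf_of_rStepW`,
`formAtZS_chainWitness_of_rStepW`) and dag-n11-e g16's p595576 `…Sect3SupplyChainObligationsDefs` (`ChainFormAt ∕ ChainFormTAt`, `SupplierObligations`, `NoExpansionObligation`,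
`SupplyChainAt`, `OperandRowsAlongChain`, `ResidualRows`, `chainFormTAt_of_chainFormAt`, `sLaw₁₃CoPH_of_chainFormAt`, `tLaw₁₃CoPH_of_chainFormTAt`, §5's two discharges of the
no-expansion obligation).

WHY THIS FILE.  p595576 NAMES the five hypothesis families of the witness chain that every consumer re-spelled — all but the SIXTH, the 𝐑-side: there the chain runs «on the
live-selector line» (core provisos row `rstep` + selector clause + admissibility + `0 ≤ κ, E₀`).  p594830 showed that what the chain reads of 𝐑 is EXACTLY the witness-level step
  (𝐑ʷ)_k :  every 𝐓-image witness `(tT, EkT)` at level `k` (laws `Sect2.LawsT … k`, 𝐓-image clause over `slotsTOfRecord … (k+1)`) IS a §2 witness of `ρ_{k+1}` (laws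
            `Sect2.LawsRT … (k+1)`, clause over `slotsOfRecord … (k+1)`) — SAME term values and constants,
spelled as an 8-line hypothesis in each of its 17 theorems.  THIS FILE names it ONCE — `RStepWAt θ p k`, `RStepW θ p := ∀ k < K, RStepWAt θ p k` ([III] p. 244 L36–38 «we will only
assume that [𝐑] has some properties incorporated in the inductive description of the effective actions», read for THE GIVEN 𝐓-image witness; STRONGER than the law-level leaf
`ROpLeaf (VOfRecord₁₃CoPH θ p) ⟺ ∀ k < K, TLaw_k → SLaw_{k+1}`, which it implies (§3) and which does not name the witness; print's 𝐑 of [IV] (0.4)–(0.6) also adds its own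
level-`(k+1)` terms — (𝐑ʷ) with the same terms is the tree's live-line modelling made explicit) — and re-issues Theorem 1 ∕ the (S1ᵀ) slot ∕ the node faces at a GENERIC `θ` from ONE
TOKEN PER SIDE: `SupplierObligations θ p σ` ([III] §3), `NoExpansionObligation θ p σ` (dag-n11-d's lane; or its §5 discharges), `RStepW θ p` (the 𝐑-side) — `1 ≤ M`, `0 ≤ B₀`, nothing
else; NO selector clause, NO admissibility, NO `κ ∕ E₀` sign, NO `Provisos₁₃CoPH` on the 𝐑-side.

WHAT THIS FILE DECLARES ∕ PROVES (2 `def` with explicit binders — predicates with parameters naming a displayed hypothesis, NOTHING CLAIMED for any `θ`; 0 `sorry`; standard axioms).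
§1 `def RStepWAt θ p k` · `def RStepW θ p` · `rStepWAt_iff` · `rStepW_iff` (`Iff.rfl`).
§2 A6: ★ `RStepW.of_liveSel_of_rstep` — `RStepW θ p` HOLDS on the live-selector line (p591271 §1 ∕ p594830 §0).
§3 LAW LEVEL (dot-notation on `hR : RStepW θ p`): `RStepW.rStepLaw` · ★ `RStepW.rOpLeaf` · `RStepW.rAssumedP244`.
§4 THE CHAIN FROM THE THREE TOKENS (generic `θ`; `1 ≤ M`, `0 ≤ B₀`): ★★★ `RStepW.chainFormAt_all_of_obligations` · `RStepW.chainFormTAt_all_of_obligations` ·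
   `RStepW.sLaw₁₃CoPH_all_of_obligations` (THEOREM 1 OF [III]) · `RStepW.tLaw₁₃CoPH_all_of_obligations` · `RStepW.thmP245Laws_of_obligations` · `RStepW.sLaw₁₃CoPH_all_of_supplyChainAt`
   (from N11's one-token residual `SupplyChainAt θ p` + `RStepW θ p`) · `RStepW.thmP245Laws_of_supplyChainAt`.
§5 NODE FACES FROM THE TOKENS: `RStepW.densitiesDescribed_of_supplyChainAt_core` (PROVISO-FREE) · `RStepW.densitiesDescribed_of_supplyChainAt` · ★★ `RStepW.b14_main_of_supplyChainAt` ·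
   ★ `RStepW.thm1Printed_datumOfRecord₁₃CoPH_of_supplyChainAt` (per windowed run: `SupplyChainAt θ P ∧ RStepW θ P`) · `RStepW.thm1Printed_datumOfRecord₁₃SepCoPH_of_supplyChainAt`.
§6 WITH p595576 §5's DISCHARGES OF THE NO-EXPANSION OBLIGATION: `RStepW.sLaw₁₃CoPH_all_of_obligations_of_rows` (dag-n11-d's `ResidualRows` + def-T's `OperandRowsAlongChain`; core
   provisos + `ZhUnity` are the rows' keys) · ★★ `RStepW.sLaw₁₃CoPH_all_of_obligations_of_gaussCert` (ANY `θ` of the Gaussian-certificate class: operand rows alone).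

HONEST FRAMING.  Count-neutral KERNEL BOOKKEEPING: two named predicates for a displayed hypothesis and one-line compositions of landed theorems; `RStepW`, `SupplierObligations`,
`NoExpansionObligation` ∕ the rows are DISPLAYED, not proved (except `RStepW` on the live-selector line, §2); nothing of Bałaban is asserted; N11 is NOT discharged; K1⁷ is NOT closed;
counts unmoved (typed 28∕28 · discharged 5∕27).  One finite `𝕋⁴_{L^K}` programme at fixed `ε = L^{−K}`; R4 closes only the conditional finite-𝕋⁴ rung `BalabanLadder.UV` — NOT ℝ⁴,
NOT OS, NOT a mass gap, NOT Clay.  No `sorry`, no `axiom`, no `instance`, no `notation`.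
Sources: [III] Theorem p.245, p.244 L36–38, Thm 1 p.262, Thm 2 p.263, §2 p.262, remark p.262, §3 p.279, (3.24)–(3.25) p.270, (2.17)–(2.18) p.257, (2.23)–(2.31) pp.258–260, (2.40)–(2.42)
p.261; [IV] (0.2)–(0.6) pp.176–177, p.177 (i)–(ii); [B16] Thm 1 p.355 (the assumption's source, not exercised).
-/

noncomputable section

open MeasureTheory
open scoped BigOperators ENNReal NNReal Matrix.Norms.L2Operator

namespace Summit.QuantumFields.YangMills.Theorems.BalabanUVNodesN11RStepWitnessDefs

open Literature.MathematicalPhysics.QuantumFieldTheory.Balaban1983to89 T4Continuum Node00 Node00.Tk DagBinding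
open B10Eq42TorusConstraint (bondsIn)
open Literature.MathematicalPhysics.QuantumFieldTheory.Balaban1983to89.B16RLeafRecord13LiveCoPH (densitiesDescribed_leavesP_iff_sLaw₁₃CoPH_all
  densitiesDescribed_at_record₁₃CoPH_of_laws b14_main_at_record₁₃CoPH_of_rOpLeaf)
open BalabanUVNodesN11HistoryPinnedResidualDefs (ZhPinOfRecord₁₃)
open BalabanUVNodesN11FluctTruncationDefs (IsFluctLocal)
open BalabanUVNodesN11Sect3SupplyChainDefs
open BalabanUVNodesN11Sect3SupplyChain (formAtZS_succ_of_formT_of_liveSel_of_rstep)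
open BalabanUVNodesN11Sect3SupplyChainObligationsDefs
open BalabanUVNodesN11ThmP245OfSupplyChainRAssumedCoPH (rStepLaw_of_rStepW rOpLeaf_of_rStepW rAssumedP244_of_rStepW formAtZS_chainWitness_of_rStepW)

variable {F : T4Family} {N : ℕ} [NeZero N]

/-! ## §1. The tokens -/

section Defs

/-- **(𝐑ʷ)_k — THE WITNESS-LEVEL 𝐑-STEP AT LEVEL `k` OF THE RUN `p` AT `θ`**: every 𝐓-image witness `(tT, EkT)` at level `k` — term values and constants per history of length `k+1` with
the laws `Sect2.LawsT … k` on the tower of record and the 𝐓-image clause over the pre-𝐑 slots `𝐓ρ_k` of record — IS a §2 witness of `ρ_{k+1}` WITH THE SAME TERM VALUES AND CONSTANTS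
(laws `Sect2.LawsRT … (k+1)`, clause over the post-𝐑 slots `ρ_{k+1}` of record).  What [III] p. 244 L36–38 assumes of 𝐑, read for THE GIVEN witness (print's 𝐑 of [IV] (0.4)–(0.6) also
adds its own level-`(k+1)` terms; (𝐑ʷ)_k keeps them all — the tree's live-line modelling, where 𝐑 of record integrates out dead sequences only).  A PREDICATE WITH PARAMETERS naming a
displayed hypothesis — NOT claimed for any `θ`; inhabited on the live-selector line (§2). [cite: Balaban1988Convergent, p.244 L36–38, §2 p.262, remark p.262, (3.24)–(3.25) p.270, (2.17)–(2.18) p.257; Balaban1989LargeFieldI, (0.2)–(0.6) pp.176–177] -/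
def RStepWAt (θ : Stage13HParams F N) (p : B12.RunParams) (k : ℕ) : Prop :=
  ∀ (tT : SeqOfRecord F θ.ν θ.τ9.M (gOfRecord₁₃ F N θ.toStage13Params p) p.K (k + 1) → Sect2.TermValues (F.P p.K) (MatA N) (FluctV N) θ.τ9.M)
    (EkT : SeqOfRecord F θ.ν θ.τ9.M (gOfRecord₁₃ F N θ.toStage13Params p) p.K (k + 1) → ℝ),
    HasSect2FormAtZS F N (FluctV N) p.K (settingOfRecord₁₃ F N θ.toStage13Params p) (k + 1) (θ.rzAt p) (WtOfRecord₁₃H F N θ p) (UbgOfRecord₁₃CoP F N θ.toStage13Params p (k + 1))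
      (fun s u => Sect2.LawsT (sect2TowerOfRecord F N (FluctV N) p.K (settingOfRecord₁₃ F N θ.toStage13Params p) (θ.rzAt p s) s u) (settingOfRecord₁₃ F N θ.toStage13Params p).lf (settingOfRecord₁₃ F N θ.toStage13Params p).βc k)
      (slotsTOfRecord F N θ.ν θ.τ9 (EOfRecord₁₃ F N θ.toStage13Params) (wOfRecord₉ F N θ.toStage9Params) θ.ppSel p (gOfRecord₁₃ F N θ.toStage13Params p) (k + 1)) tT EkT →
    HasSect2FormAtZS F N (FluctV N) p.K (settingOfRecord₁₃ F N θ.toStage13Params p) (k + 1) (θ.rzAt p) (WtOfRecord₁₃H F N θ p) (UbgOfRecord₁₃CoP F N θ.toStage13Params p (k + 1))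
      (fun s u => Sect2.LawsRT (sect2TowerOfRecord F N (FluctV N) p.K (settingOfRecord₁₃ F N θ.toStage13Params p) (θ.rzAt p s) s u) (settingOfRecord₁₃ F N θ.toStage13Params p).lf (k + 1))
      (slotsOfRecord F N θ.ν θ.τ9 (EOfRecord₁₃ F N θ.toStage13Params) (wOfRecord₉ F N θ.toStage9Params) θ.ppSel p (gOfRecord₁₃ F N θ.toStage13Params p) (k + 1)) tT EkT

/-- **(𝐑ʷ) — THE WITNESS-LEVEL 𝐑-STEP ALONG THE RUN `p` AT `θ`**: `(𝐑ʷ)_k` at every level `k < K`.  The 𝐑-side token of N11 at a generic v1.7 parameter (the supply-side tokens are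
dag-n11-e's `SupplierObligations θ p σ` ∕ `NoExpansionObligation θ p σ` ∕ `SupplyChainAt θ p`).  A predicate with parameters; NOT claimed for any `θ`. [cite: Balaban1988Convergent, p.244 L36–38, remark p.262; Balaban1989LargeFieldI, (0.2)–(0.3) p.176] -/
def RStepW (θ : Stage13HParams F N) (p : B12.RunParams) : Prop :=
  ∀ k, k < p.K → RStepWAt θ p k

variable (θ : Stage13HParams F N) (p : B12.RunParams)

/-- `RStepWAt` unfolds to the displayed witness-level step (`Iff.rfl`). [cite: Balaban1988Convergent, p.244 L36–38 (bookkeeping)] -/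
theorem rStepWAt_iff (k : ℕ) :
    RStepWAt θ p k ↔
      ∀ (tT : SeqOfRecord F θ.ν θ.τ9.M (gOfRecord₁₃ F N θ.toStage13Params p) p.K (k + 1) → Sect2.TermValues (F.P p.K) (MatA N) (FluctV N) θ.τ9.M)
        (EkT : SeqOfRecord F θ.ν θ.τ9.M (gOfRecord₁₃ F N θ.toStage13Params p) p.K (k + 1) → ℝ),
        HasSect2FormAtZS F N (FluctV N) p.K (settingOfRecord₁₃ F N θ.toStage13Params p) (k + 1) (θ.rzAt p) (WtOfRecord₁₃H F N θ p) (UbgOfRecord₁₃CoP F N θ.toStage13Params p (k + 1))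
          (fun s u => Sect2.LawsT (sect2TowerOfRecord F N (FluctV N) p.K (settingOfRecord₁₃ F N θ.toStage13Params p) (θ.rzAt p s) s u) (settingOfRecord₁₃ F N θ.toStage13Params p).lf (settingOfRecord₁₃ F N θ.toStage13Params p).βc k)
          (slotsTOfRecord F N θ.ν θ.τ9 (EOfRecord₁₃ F N θ.toStage13Params) (wOfRecord₉ F N θ.toStage9Params) θ.ppSel p (gOfRecord₁₃ F N θ.toStage13Params p) (k + 1)) tT EkT →
        HasSect2FormAtZS F N (FluctV N) p.K (settingOfRecord₁₃ F N θ.toStage13Params p) (k + 1) (θ.rzAt p) (WtOfRecord₁₃H F N θ p) (UbgOfRecord₁₃CoP F N θ.toStage13Params p (k + 1))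
          (fun s u => Sect2.LawsRT (sect2TowerOfRecord F N (FluctV N) p.K (settingOfRecord₁₃ F N θ.toStage13Params p) (θ.rzAt p s) s u) (settingOfRecord₁₃ F N θ.toStage13Params p).lf (k + 1))
          (slotsOfRecord F N θ.ν θ.τ9 (EOfRecord₁₃ F N θ.toStage13Params) (wOfRecord₉ F N θ.toStage9Params) θ.ppSel p (gOfRecord₁₃ F N θ.toStage13Params p) (k + 1)) tT EkT := Iff.rfl

/-- `RStepW` unfolds to «(𝐑ʷ)_k at every `k < K`» (`Iff.rfl`). [cite: Balaban1988Convergent, p.244 L36–38 (bookkeeping)] -/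
theorem rStepW_iff : RStepW θ p ↔ ∀ k, k < p.K → RStepWAt θ p k := Iff.rfl

end Defs

/-! ## §2. A6 — `RStepW θ p` is inhabited on the live-selector line -/

section Instance

variable (θ : Stage13HParams F N) (p : B12.RunParams)

/-- **★ A6 — `RStepW θ p` HOLDS ON THE LIVE-SELECTOR LINE** (core provisos row `rstep`, the selector clause, admissibility, `0 ≤ κ, E₀, B₀`): dag-n11-e's p591271 §1
`formAtZS_succ_of_formT_of_liveSel_of_rstep` (𝐑 of record moves only dead sequences; the laws weaken by 11c's `toRT_succ`).
[cite: Balaban1988Convergent, §2 p.262, (3.24)–(3.25) p.270, p.244 L36–38; Balaban1989LargeFieldI, (0.2)–(0.4) p.176, p.177 (i)–(ii)] -/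
theorem RStepW.of_liveSel_of_rstep (h : θ.Provisos₁₃CoPH F N)
    (hsel : θ.ppSel = ppSelLiveOfRecord F N θ.ν θ.τ9 (EOfRecord₁₃ F N θ.toStage13Params) (wOfRecord₉ F N θ.toStage9Params))
    (hθ : θ.Admissible F N) (hκ : 0 ≤ θ.s2.lf.κ) (hE₀ : 0 ≤ θ.s2.lf.E₀) (hB₀ : 0 ≤ θ.s2.lf.B₀) : RStepW θ p :=
  fun _ hk tT EkT hT => formAtZS_succ_of_formT_of_liveSel_of_rstep θ p h hsel hθ hκ hE₀ hB₀ hk tT EkT hT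

end Instance

/-! ## §3. Law level through the token -/

section LawLevel

variable {θ : Stage13HParams F N} {p : B12.RunParams}

/-- **`RStepW θ p` ⇒ the law form `∀ k < K, TLaw₁₃CoPH θ p k → SLaw₁₃CoPH θ p (k+1)`** (p594830 §1). [cite: Balaban1988Convergent, p.244 L36–38, remark p.262] -/
theorem RStepW.rStepLaw (hR : RStepW θ p) : ∀ k, k < p.K → TLaw₁₃CoPH F N θ p k → SLaw₁₃CoPH F N θ p (k + 1) :=
  rStepLaw_of_rStepW θ p hR

/-- **★ `RStepW θ p` ⇒ [III]'s p. 244 OBJECT OF RECORD `ROpLeaf (VOfRecord₁₃CoPH θ p)`** (p594830 §1; the converse does not hold in general and is not claimed).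
[cite: Balaban1988Convergent, p.244 L36–38, remark p.262; Balaban1989LargeFieldI, (0.2)–(0.3) p.176] -/
theorem RStepW.rOpLeaf (hR : RStepW θ p) : ROpLeaf (VOfRecord₁₃CoPH F N θ p) :=
  rOpLeaf_of_rStepW θ p hR

/-- **`RStepW θ p` ⇒ `B14.RAssumedP244` at the 𝐑-carriers of record** ([III]'s own name; p594830 §1). [cite: Balaban1988Convergent, p.244 L36–38, Thm 1 p.262] -/
theorem RStepW.rAssumedP244 (hR : RStepW θ p) :
    B14.RAssumedP244 (VOfRecord₁₃CoPH F N θ p).R (VOfRecord₁₃CoPH F N θ p).Scorr (VOfRecord₁₃CoPH F N θ p).S p.K :=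
  rAssumedP244_of_rStepW θ p hR

end LawLevel

/-! ## §4. Theorem 1 along the witness chain from the three tokens, generic `θ` -/

section Chain

variable {θ : Stage13HParams F N} {p : B12.RunParams}

/-- **★★★ THE CHAIN HAS THE §2 FORM OF `ρ_k` AT EVERY `k ≤ K` FROM `SupplierObligations θ p σ`, `NoExpansionObligation θ p σ` AND `RStepW θ p`** — generic `θ`, `1 ≤ M`, `0 ≤ B₀`;
p594830's `formAtZS_chainWitness_of_rStepW` read through dag-n11-e's names (compare p595576 `chainFormAt_all_of_obligations`: the same on the live-selector line).
[cite: Balaban1988Convergent, Thm 1 p.262, Theorem p.245, Thm 2 p.263, §3 p.279, (3.24)–(3.25) p.270, p.244 L36–38] -/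
theorem RStepW.chainFormAt_all_of_obligations (hR : RStepW θ p) (hM : 1 ≤ θ.τ9.M) (hB₀ : 0 ≤ θ.s2.lf.B₀) (σ : Sect3Supplier θ p)
    (hσ : SupplierObligations θ p σ) (hT : NoExpansionObligation θ p σ) : ∀ k, k ≤ p.K → ChainFormAt θ p σ k :=
  formAtZS_chainWitness_of_rStepW θ p σ hσ.univE hσ.newE hσ.present hT hR hM hB₀

/-- **THE CHAIN's 𝐓-IMAGES AT EVERY `k < K` from the three tokens** (p595576 `chainFormTAt_of_chainFormAt` at §4's form). [cite: Balaban1988Convergent, Theorem p.245, §3 p.279, (3.24)–(3.25) p.270] -/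
theorem RStepW.chainFormTAt_all_of_obligations (hR : RStepW θ p) (hM : 1 ≤ θ.τ9.M) (hB₀ : 0 ≤ θ.s2.lf.B₀) (σ : Sect3Supplier θ p)
    (hσ : SupplierObligations θ p σ) (hT : NoExpansionObligation θ p σ) : ∀ k, k < p.K → ChainFormTAt θ p σ k := fun k hk =>
  chainFormTAt_of_chainFormAt hM hB₀ σ hσ hT hk (RStepW.chainFormAt_all_of_obligations hR hM hB₀ σ hσ hT k hk.le)

/-- **★★★ THEOREM 1 OF [III] AT `θ`, ALL LEVELS, ALL HISTORIES — `∀ k ≤ K, SLaw₁₃CoPH θ p k` — FROM `SupplierObligations`, `NoExpansionObligation` AND `RStepW`, GENERIC `θ`.**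
[cite: Balaban1988Convergent, Thm 1 p.262, Theorem p.245, p.244 L36–38; Balaban1989LargeFieldI, (0.2)–(0.4) p.176] -/
theorem RStepW.sLaw₁₃CoPH_all_of_obligations (hR : RStepW θ p) (hM : 1 ≤ θ.τ9.M) (hB₀ : 0 ≤ θ.s2.lf.B₀) (σ : Sect3Supplier θ p)
    (hσ : SupplierObligations θ p σ) (hT : NoExpansionObligation θ p σ) : ∀ k, k ≤ p.K → SLaw₁₃CoPH F N θ p k := fun k hk =>
  sLaw₁₃CoPH_of_chainFormAt (RStepW.chainFormAt_all_of_obligations hR hM hB₀ σ hσ hT k hk)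

/-- **THE 𝐓-IMAGE LAWS `TLaw₁₃CoPH θ p k` AT EVERY `k < K` from the three tokens** — the «corresponding space» clause WITNESSED by the splice.
[cite: Balaban1988Convergent, Theorem p.245, remark p.262, §3 p.279, (3.25) p.270] -/
theorem RStepW.tLaw₁₃CoPH_all_of_obligations (hR : RStepW θ p) (hM : 1 ≤ θ.τ9.M) (hB₀ : 0 ≤ θ.s2.lf.B₀) (σ : Sect3Supplier θ p)
    (hσ : SupplierObligations θ p σ) (hT : NoExpansionObligation θ p σ) : ∀ k, k < p.K → TLaw₁₃CoPH F N θ p k := fun k hk =>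
  tLaw₁₃CoPH_of_chainFormTAt (RStepW.chainFormTAt_all_of_obligations hR hM hB₀ σ hσ hT k hk)

/-- **THE THEOREM OF p. 245 IN LAW FORM — `∀ k < K, SLaw₁₃CoPH θ p k → TLaw₁₃CoPH θ p k` — from the three tokens** (the input shape of every node dictionary).
[cite: Balaban1988Convergent, Theorem p.245, Thm 1 p.262, remark p.262] -/
theorem RStepW.thmP245Laws_of_obligations (hR : RStepW θ p) (hM : 1 ≤ θ.τ9.M) (hB₀ : 0 ≤ θ.s2.lf.B₀) (σ : Sect3Supplier θ p)
    (hσ : SupplierObligations θ p σ) (hT : NoExpansionObligation θ p σ) : ∀ k, k < p.K → SLaw₁₃CoPH F N θ p k → TLaw₁₃CoPH F N θ p k :=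
  fun k hk _ => RStepW.tLaw₁₃CoPH_all_of_obligations hR hM hB₀ σ hσ hT k hk

/-- **★ THEOREM 1 OF [III] AT `θ` FROM N11's ONE-TOKEN SUPPLY RESIDUAL `SupplyChainAt θ p` AND THE 𝐑-SIDE TOKEN `RStepW θ p`** — generic `θ`, `1 ≤ M`, `0 ≤ B₀`, nothing else
(compare p595576 `sLaw₁₃CoPH_all_of_supplyChainAt` on the live-selector line). [cite: Balaban1988Convergent, Thm 1 p.262, Theorem p.245, p.244 L36–38; Balaban1989LargeFieldI, (0.2)–(0.4) p.176] -/
theorem RStepW.sLaw₁₃CoPH_all_of_supplyChainAt (hR : RStepW θ p) (hM : 1 ≤ θ.τ9.M) (hB₀ : 0 ≤ θ.s2.lf.B₀) (hN : SupplyChainAt θ p) :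
    ∀ k, k ≤ p.K → SLaw₁₃CoPH F N θ p k := by
  obtain ⟨σ, hσ, hT⟩ := hN
  exact RStepW.sLaw₁₃CoPH_all_of_obligations hR hM hB₀ σ hσ hT

/-- **THE THEOREM OF p. 245 IN LAW FORM from `SupplyChainAt θ p` and `RStepW θ p`.** [cite: Balaban1988Convergent, Theorem p.245, Thm 1 p.262] -/
theorem RStepW.thmP245Laws_of_supplyChainAt (hR : RStepW θ p) (hM : 1 ≤ θ.τ9.M) (hB₀ : 0 ≤ θ.s2.lf.B₀) (hN : SupplyChainAt θ p) :
    ∀ k, k < p.K → SLaw₁₃CoPH F N θ p k → TLaw₁₃CoPH F N θ p k := by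
  obtain ⟨σ, hσ, hT⟩ := hN
  exact RStepW.thmP245Laws_of_obligations hR hM hB₀ σ hσ hT

end Chain

/-! ## §5. The node faces from the tokens -/

section Node

variable {θ : Stage13HParams F N} (p : B12.RunParams)

/-- **★ N11's NODE SENTENCE `densitiesDescribed` — PROVISO-FREE — at ANY world whose C-binding is the CoPH core's construction over the densities of record, from `SupplyChainAt θ p`
and `RStepW θ p`** (p540794 `densitiesDescribed_leavesP_iff_sLaw₁₃CoPH_all`).  Generic `θ`. [cite: Balaban1988Convergent, Thm 1 p.262, Theorem p.245, p.244 L36–38] -/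
theorem RStepW.densitiesDescribed_of_supplyChainAt_core (hR : RStepW θ p) (hM : 1 ≤ θ.τ9.M) (hB₀ : 0 ≤ θ.s2.lf.B₀) (hN : SupplyChainAt θ p)
    (w : WorldP) (hC : w.C = (coreOfRecord₁₃CoPH F N θ).construction (densOfRecord₁₃ F N θ.toStage13Params)) : (leavesP w p).densitiesDescribed :=
  (densitiesDescribed_leavesP_iff_sLaw₁₃CoPH_all F N θ p w hC).2 (RStepW.sLaw₁₃CoPH_all_of_supplyChainAt hR hM hB₀ hN)

/-- **N11's NODE SENTENCE `densitiesDescribed` AT A WORLD BOUND TO THE CoPH DATUM OF `θ`** (`w.C = (datumOfRecord₁₃CoPH θ h).C`; `h` only keys the datum) from `SupplyChainAt θ p` and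
`RStepW θ p` (p540794 `densitiesDescribed_at_record₁₃CoPH_of_laws`). [cite: Balaban1988Convergent, Thm 1 p.262, Theorem p.245, p.244 L36–38] -/
theorem RStepW.densitiesDescribed_of_supplyChainAt (hR : RStepW θ p) (h : θ.Provisos₁₃CoPH F N) (hM : 1 ≤ θ.τ9.M) (hB₀ : 0 ≤ θ.s2.lf.B₀) (hN : SupplyChainAt θ p)
    (w : WorldP) (hC : w.C = (datumOfRecord₁₃CoPH F N θ h).C) : (leavesP w p).densitiesDescribed :=
  densitiesDescribed_at_record₁₃CoPH_of_laws F N θ p w h hC hR.rStepLaw (RStepW.thmP245Laws_of_supplyChainAt hR hM hB₀ hN)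

/-- **★★ N11's DAG NODE `Dag.B14_main (leavesP w p)` AT A WORLD C-BOUND TO THE CoPH DATUM FROM `SupplyChainAt θ p` AND `RStepW θ p`**: the node's own 𝐑-antecedent is NOT READ
(`RStepW` gives the leaf, §3), nor are `b7 … b11`, `smallCouplings`, `smallFieldInductive`, `flowControl` (p540794 `b14_main_at_record₁₃CoPH_of_rOpLeaf`).
[cite: Balaban1988Convergent, Thm 1 p.262, Theorem p.245, p.244 L36–38; Balaban1989LargeFieldII, Thm 1 p.355 (the in-edge's source, not exercised)] -/
theorem RStepW.b14_main_of_supplyChainAt (hR : RStepW θ p) (h : θ.Provisos₁₃CoPH F N) (hM : 1 ≤ θ.τ9.M) (hB₀ : 0 ≤ θ.s2.lf.B₀) (hN : SupplyChainAt θ p)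
    (w : WorldP) (hC : w.C = (datumOfRecord₁₃CoPH F N θ h).C) : Dag.B14_main (leavesP w p) :=
  b14_main_at_record₁₃CoPH_of_rOpLeaf F N θ p w h hC (fun _ => hR.rOpLeaf) (fun _ _ _ _ _ _ _ _ => RStepW.thmP245Laws_of_supplyChainAt hR hM hB₀ hN)

variable (θ)

/-- **★ `B16.Thm1Printed (datumOfRecord₁₃CoPH θ h).C` — [III] THEOREM 1 AT THE CoPH DATUM OF `θ` — FROM, PER WINDOWED RUN `P`, THE TWO TOKENS `SupplyChainAt θ P` AND `RStepW θ P`**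
(def-T's `thm1Printed_datumOfRecord₁₃CoPH_of_tLaw_rOpLeaf`; `1 ≤ M`, `0 ≤ B₀`; `h` only keys the datum).  Generic `θ`.
[cite: Balaban1988Convergent, Thm 1 p.262, Theorem p.245, p.244 L36–38; Balaban1989LargeFieldII, Thm 1 p.355 (not exercised)] -/
theorem RStepW.thm1Printed_datumOfRecord₁₃CoPH_of_supplyChainAt (h : θ.Provisos₁₃CoPH F N) (hM : 1 ≤ θ.τ9.M) (hB₀ : 0 ≤ θ.s2.lf.B₀) {γ : ℝ} (hγ : 0 < γ)
    (hN : ∀ P : B12.RunParams, ((datumOfRecord₁₃CoPH F N θ h).C P).flow.InInterval γ P.K → SupplyChainAt θ P)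
    (hR : ∀ P : B12.RunParams, ((datumOfRecord₁₃CoPH F N θ h).C P).flow.InInterval γ P.K → RStepW θ P) :
    B16.Thm1Printed (datumOfRecord₁₃CoPH F N θ h).C :=
  thm1Printed_datumOfRecord₁₃CoPH_of_tLaw_rOpLeaf F N θ h hγ (fun P hP => RStepW.thmP245Laws_of_supplyChainAt (hR P hP) hM hB₀ (hN P hP)) fun P hP => (hR P hP).rOpLeaf

/-- **`B16.Thm1Printed` AT THE v1.7 SEPARATED-RANGE DATUM `datumOfRecord₁₃SepCoPH θ h`** (`h : Provisos₁₃SepCoPH`, the K1⁷ item's key) from, per windowed run, `SupplyChainAt θ P` and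
`RStepW θ P`. [cite: Balaban1988Convergent, Thm 1 p.262, Theorem p.245, p.244 L36–38; Balaban1989LargeFieldII, Thm 1 p.355 (not exercised)] -/
theorem RStepW.thm1Printed_datumOfRecord₁₃SepCoPH_of_supplyChainAt (h : θ.Provisos₁₃SepCoPH F N) (hM : 1 ≤ θ.τ9.M) (hB₀ : 0 ≤ θ.s2.lf.B₀) {γ : ℝ} (hγ : 0 < γ)
    (hN : ∀ P : B12.RunParams, ((datumOfRecord₁₃SepCoPH F N θ h).C P).flow.InInterval γ P.K → SupplyChainAt θ P)
    (hR : ∀ P : B12.RunParams, ((datumOfRecord₁₃SepCoPH F N θ h).C P).flow.InInterval γ P.K → RStepW θ P) :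
    B16.Thm1Printed (datumOfRecord₁₃SepCoPH F N θ h).C :=
  RStepW.thm1Printed_datumOfRecord₁₃CoPH_of_supplyChainAt θ h.toCore hM hB₀ hγ hN hR

end Node

/-! ## §6. With p595576 §5's discharges of the no-expansion obligation -/

section Discharge

variable {θ : Stage13HParams F N} {p : B12.RunParams}

/-- **THEOREM 1 OF [III] AT `θ` FROM `SupplierObligations`, dag-n11-d's ROWS (`ResidualRows θ p`, witness-free) + def-T's `OperandRowsAlongChain θ p σ`, AND `RStepW θ p`** — generic `θ`;
core provisos `h` and `ZhUnity` are the ROWS' keys (old-branch integrability), `1 ≤ M`, `0 ≤ B₀` (p595576 §5 `noExpansionObligation_of_residualRows_of_operandRows` inside §4).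
[cite: Balaban1988Convergent, Thm 1 p.262, Theorem p.245, (3.24)–(3.25) p.270, (3.16)–(3.21) pp.268–269, p.244 L36–38; Balaban1989LargeFieldI, (0.2)–(0.3) p.176] -/
theorem RStepW.sLaw₁₃CoPH_all_of_obligations_of_rows (hR : RStepW θ p) (h : θ.Provisos₁₃CoPH F N) (hU : θ.ZhUnity F N) (hM : 1 ≤ θ.τ9.M) (hB₀ : 0 ≤ θ.s2.lf.B₀)
    (σ : Sect3Supplier θ p) (hσ : SupplierObligations θ p σ) (hres : ResidualRows θ p) (hops : OperandRowsAlongChain θ p σ) :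
    ∀ k, k ≤ p.K → SLaw₁₃CoPH F N θ p k :=
  RStepW.sLaw₁₃CoPH_all_of_obligations hR hM hB₀ σ hσ (noExpansionObligation_of_residualRows_of_operandRows h hU hM σ hσ.loc hres hops)

/-- **★★ THEOREM 1 OF [III] AT ANY `θ` OF THE GAUSSIAN-CERTIFICATE CLASS FROM `SupplierObligations`, def-T's `OperandRowsAlongChain` ALONE ON THE ROWS' SIDE, AND `RStepW θ p`** —
certificate `ζ0`, A-fibre Gaussian `quad`, core provisos, `1 ≤ M`, `0 ≤ B₀`; NO `ZhUnity`, NO residual row, NO K0b row (p595576 §5 `noExpansionObligation_of_gaussCert_of_operandRows`,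
dag-n11-w1's p592749 behind it); NO selector clause ∕ admissibility ∕ `κ, E₀` sign on the 𝐑-side. [cite: Balaban1988Convergent, Thm 1 p.262, Theorem p.245, (3.24)–(3.25) p.270, (3.23) p.270, (2.23) p.258, p.244 L36–38] -/
theorem RStepW.sLaw₁₃CoPH_all_of_obligations_of_gaussCert (hR : RStepW θ p)
    (hζ : ∀ (p : B12.RunParams) (n : ℕ) (Ω Λ : ℕ → Set (Site (F.P p.K) 0)), (θ.Zh p n Ω Λ).ζ0 = (ZhPinOfRecord₁₃ θ.toStage13Params p Ω Λ).ζ0)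
    (hq : ∀ (p : B12.RunParams) (n : ℕ) (Ω Λ : ℕ → Set (Site (F.P p.K) 0)) (j : ℕ) (Λ' : Set (Site (F.P p.K) 0)) (ω : MultiCfg (F.P p.K) (SU N) (FluctV N)),
      (θ.Zh p n Ω Λ).quad j Λ' ω = ∑ b ∈ (Set.toFinite (bondsIn j (Λ'ᶜ ∩ Ω (j + 1)))).toFinset, ‖(ω j).2 b‖ ^ 2)
    (h : θ.Provisos₁₃CoPH F N) (hM : 1 ≤ θ.τ9.M) (hB₀ : 0 ≤ θ.s2.lf.B₀) (σ : Sect3Supplier θ p) (hσ : SupplierObligations θ p σ) (hops : OperandRowsAlongChain θ p σ) :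
    ∀ k, k ≤ p.K → SLaw₁₃CoPH F N θ p k :=
  RStepW.sLaw₁₃CoPH_all_of_obligations hR hM hB₀ σ hσ (noExpansionObligation_of_gaussCert_of_operandRows hζ hq h hM σ hσ.loc hops)

end Discharge

end Summit.QuantumFields.YangMills.Theorems.BalabanUVNodesN11RStepWitnessDefs

end
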